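import Summits.QuantumFields.YangMills.Theorems.BalabanUVNodesN15PerCubeGreenAdjointGreen
import Summits.QuantumFields.YangMills.Theorems.BalabanUVNodesN15PerCubeGreenFineSummand
import Summits.QuantumFields.YangMills.Theorems.BalabanUVNodesN15PerCubeGreenFineAdjointRows
import Summits.QuantumFields.YangMills.Theorems.BalabanUVNodesN15CommutatorOutputSupport
import HarnessLib

/-!
# N15 = NE2, road (c) — PROGRAMME (PC), (PC-E-K) ENTRY 2 «`G′(U)∇*_U` of [B9] (3.42), TWO GRIDS»: SITE ROWS OF BAŁABAN's SUMMAND AND PERTURBATIONS FOR THE ADJOINT KNIT — the adjoint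
# FAR ROWS `M_{h_k}N_V k(1 − M_{χ̃_k}) = 0` of the perturbations `N_V = a·Q′₁ᵀQ′₁ − M_W P M_{Wᵀ}` at BOTH grids (EXACT zeros by block-diagonality) and the RIGHT locality
# `M_{h′_k}P′M_{1−ψ′_k} = 0` of the fine summand `P′ = a·Q′_T(U′)ᵀQ′_T(U′)` (n15-c∕429's displayed `hPloc′`; n15-c∕427's `hfarN`, `hfarN′`, `hDfarNa` become zeros) (dag-n15-c g37, n15-c∕430a)

Cell `pub-ymgap`, seat `pub-ymgap-dag-n15-c` (generation g37; R134 (a), s1; HUMAN RULING D-0062).  `bears_on: R4∕N15 · K3⁸ SpineGivenEndpointR13SepCoPHV (stmt-QuantumFields-27366)`;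
filed `--kind proof --supports stmt-QuantumFields-27366 --as helper` — COUNT-NEUTRAL.  Theorems only; 0 `def`, 0 `sorry`.  Imports BY NAME n15-c∕286 `…PerCubeGreenAdjointGreen`
(`mulOp_comp_mulVecLin_comp_one_sub_mulOp_eq_zero`; through it n15-c∕265 `scNV_eq`, `csavgSq_sub_apply_of_ne`, n15-c∕261 `scBump_eq_one_of_scH_ne_zero_of_blockOf_eq`), n15-c∕265′
`…PerCubeGreenFineSummand` (`scP'`, `scNV'`, `scNV'_eq`, `csavgSq_sub_apply_of_ne'`; n15-c∕326 `scBump'_eq_one_of_scH'_ne_zero_of_blockOf_eq`), n15-c∕428b `…PerCubeGreenFineAdjointRows`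
(`scPsi'_near_scChi'`), dag-n15-a `…CommutatorOutputSupport` (`mulOp_comp_csavgGram_comp_mulOp_eq_zero`).  Nothing in the tree is modified; nothing restated.

WHY.  The site knit n15-c∕429 (`uN_idef_scAdj_rightInverse_tr`, ✓) displays, among the summand ∕ perturbation data, the adjoint far rows `hfarN`∕`hfarN′` (letter `θ_F`), their two-grid
defect `hDfarNa` (letter `r_fa`) and the fine summand's right locality `hPloc′`.  For Bałaban's summand `P := scP`, `P′ := scP′` and perturbations `N_V k := scNV … k` (n15-c∕265∕265′) the
far rows VANISH exactly (the perturbation is block-diagonal and the bump `χ̃_k` is `1` on every block the partition function `h_k` meets — n15-c∕286's argument, here as named lemmas at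
both grids), so `θ_F = r_fa = 0`; and the right locality holds because the covariant Gram is block-diagonal and a block meeting `supp h′_k` lies in the box hence under the plateau.

WHAT.  §1 `mulOp_comp_mulVecLin_comp_one_sub_mulOp_eq_zero'` (the fine twin of n15-c∕286's block-diagonal lemma).  §2 ★★ `mulOp_scH_comp_scNV_comp_one_sub_scBump`,
★★ `mulOp_scH'_comp_scNV'_comp_one_sub_scBump'` (the adjoint far rows are ZERO, any unitary gauges, any bond field).  §3 ★★ `mulOp_scH'_comp_scP'_comp_one_sub_scPsi'` (the fine
summand's RIGHT locality, every `U′`).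

HONEST FRAMING ∕ LIMITS.  Exact algebra on the MODEL site carriers (block-diagonality of the covariant Gram `Q′_TᵀQ′_T`, [B9] (3.19)∕(3.24)); nothing of [B5]∕[B6]∕[B9] asserted ((3.24)
p.394, (3.59)–(3.60) p.402, (3.87)–(3.89) p.409 = SHAPES).  NE2⁺ NOT PRINTED, NOT proved; N15 of record untouched (DISCHARGED AS CONSUMED, p687738); K3⁸ OPEN; counts of record UNMOVED
(typed 28∕28 · discharged 8∕27); one finite 𝕋⁴ at fixed ε per index — NOT infinite volume, NOT OS on ℝ⁴, NOT a mass gap, NOT Clay.  Restate-immune (no Theses import).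
-/

noncomputable section

open scoped BigOperators Matrix Matrix.Norms.L2Operator

namespace Summit.QuantumFields.YangMills.BalabanUVNodes.N15.Gluing

open Real
open Literature.MathematicalPhysics.QuantumFieldTheory.Balaban1983to89
open Literature.MathematicalPhysics.QuantumFieldTheory.Balaban1983to89.B5Prop11Plancherel (Tor fine unitVec)
open Literature.MathematicalPhysics.QuantumFieldTheory.Balaban1983to89.B6Prop26Gluing (mulOp mulOp_apply)
open Literature.MathematicalPhysics.QuantumFieldTheory.King1986.Torus (blockOf)
open Literature.Barriers.QuantumFields (traceForm)
open Summit.QuantumFields.YangMills.BalabanUVNodes.N15.MatrixSpecies (mmulOp coordMat liftBlk liftEquiv)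
open Summit.QuantumFields.YangMills.BalabanUVNodes.N15.TwoGrid (chiCube cubeBlocks)
open Summit.QuantumFields.YangMills.BalabanUVNodes.N15.CovLandau (csavg)

variable {d : ℕ}

/-! ## §1 The block-diagonal lemma on the fine grid -/

section Fine

variable {L : ℕ} [NeZero L] {mv kk r : ℕ} {hL : Odd L ∧ 1 < L} (ι : Type) [Fintype ι] [DecidableEq ι]

omit [DecidableEq ι] in
/-- a block-diagonal site matrix between a partition function and the complement of a bump that is `1` on every block the partition function meets gives zero, fine grid:
`M_h∘mulVecLin D∘(1 − M_{χ̃}) = 0` (the `ScX′` twin of n15-c∕286 `mulOp_comp_mulVecLin_comp_one_sub_mulOp_eq_zero`). [folklore] -/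
theorem mulOp_comp_mulVecLin_comp_one_sub_mulOp_eq_zero' (D : Matrix (ScX' d L mv kk r hL × ι) (ScX' d L mv kk r hL × ι) ℝ)
    (hD : ∀ p q, blockOf (L ^ r * L ^ kk) (cvM d L mv kk hL) q.1 ≠ blockOf (L ^ r * L ^ kk) (cvM d L mv kk hL) p.1 → D p q = 0) {h χ : ScX' d L mv kk r hL → ℝ}
    (hhχ : ∀ x x', h x ≠ 0 → blockOf (L ^ r * L ^ kk) (cvM d L mv kk hL) x' = blockOf (L ^ r * L ^ kk) (cvM d L mv kk hL) x → χ x' = 1) :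
    mulOp (fun p : ScX' d L mv kk r hL × ι => h p.1) ∘ₗ Matrix.mulVecLin D ∘ₗ (LinearMap.id - mulOp (fun p : ScX' d L mv kk r hL × ι => χ p.1)) = 0 := by
  classical
  refine LinearMap.ext fun f => funext fun p => ?_
  simp only [LinearMap.comp_apply, LinearMap.sub_apply, LinearMap.id_apply, mulOp_apply, LinearMap.zero_apply, Pi.zero_apply, Matrix.mulVecLin_apply, Matrix.mulVec, dotProduct,
    Pi.sub_apply]
  by_cases h0 : h p.1 = 0
  · rw [h0, zero_mul]
  · rw [Finset.sum_eq_zero, mul_zero]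
    intro q _
    by_cases hb : blockOf (L ^ r * L ^ kk) (cvM d L mv kk hL) q.1 = blockOf (L ^ r * L ^ kk) (cvM d L mv kk hL) p.1
    · rw [hhχ p.1 q.1 h0 hb, one_mul, sub_self, mul_zero]
    · rw [hD p q hb, zero_mul]

end Fine

/-! ## §2 The adjoint far rows of Bałaban's perturbations vanish, both grids -/

section FarRows

variable {L : ℕ} [NeZero L] {mv kk r : ℕ} {hL : Odd L ∧ 1 < L} (ι : Type) [Fintype ι] [DecidableEq ι] {mm : Type} [Fintype mm] [DecidableEq mm] (e : Matrix mm mm ℂ ≃L[ℝ] (ι → ℝ))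

/-- ★★ **THE ADJOINT FAR ROW OF `N_V` VANISHES** (coarse grid): `M_{h_k}∘N_V k∘(1 − M_{χ̃_k}) = 0` for `N_V k = scNV … w U k` with unitary gauges `w_k`, every bond field `U` — `N_V k` is
block-diagonal (n15-c∕265 `scNV_eq`, `csavgSq_sub_apply_of_ne`) and the bump is `1` on every block meeting `supp h_k` (n15-c∕261).  n15-c∕286's inline argument, named; n15-c∕427's `hfarN`
with `θ_F = 0`. [cite: Balaban1985BackgroundPropagators, (3.59)–(3.60) p.402, (3.24) p.394 (block structure: shape)] -/
theorem mulOp_scH_comp_scNV_comp_one_sub_scBump (he : ∀ A B : Matrix mm mm ℂ, traceForm A B = e A ⬝ᵥ e B) (hw : 0 < L ^ mv) (a : ℝ)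
    {w : (Fin (d + 1) → ZMod (2 * L)) → ScX d L mv kk hL → Matrix mm mm ℂ} (hwu : ∀ k x, (w k x)ᴴ * w k x = 1) (U : Fin (d + 1) → ScX d L mv kk hL → Matrix mm mm ℂ) (k : Fin (d + 1) → ZMod (2 * L)) :
    mulOp (fun p : ScX d L mv kk hL × ι => scH d L mv kk hL k p.1) ∘ₗ scNV d L mv kk hL a ι e w U k ∘ₗ (LinearMap.id - mulOp (fun p : ScX d L mv kk hL × ι => scBump d L mv kk hL k p.1)) = 0 := by
  rw [scNV_eq ι e he a hwu U k]
  exact mulOp_comp_mulVecLin_comp_one_sub_mulOp_eq_zero ι _ (fun p q hpq => csavgSq_sub_apply_of_ne ι a _ hpq) fun x x' hx hb => scBump_eq_one_of_scH_ne_zero_of_blockOf_eq hw hx hb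

/-- ★★ **THE ADJOINT FAR ROW OF `N′_V` VANISHES** (fine grid): the `ScX′` twin (n15-c∕265′ `scNV'_eq`, `csavgSq_sub_apply_of_ne'`, n15-c∕326 `scBump'_eq_one_of_scH'_ne_zero_of_blockOf_eq`);
n15-c∕427's `hfarN′` with `θ_F = 0` — hence also `hDfarNa` with `r_fa = 0` (the two-grid defect of two zeros). [cite: Balaban1985BackgroundPropagators, (3.59)–(3.60) p.402, (3.24) p.394 (shape)] -/
theorem mulOp_scH'_comp_scNV'_comp_one_sub_scBump' (he : ∀ A B : Matrix mm mm ℂ, traceForm A B = e A ⬝ᵥ e B) (hw : 0 < L ^ mv) (a : ℝ)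
    {w : (Fin (d + 1) → ZMod (2 * L)) → ScX' d L mv kk r hL → Matrix mm mm ℂ} (hwu : ∀ k x, (w k x)ᴴ * w k x = 1) (U : Fin (d + 1) → ScX' d L mv kk r hL → Matrix mm mm ℂ) (k : Fin (d + 1) → ZMod (2 * L)) :
    mulOp (fun p : ScX' d L mv kk r hL × ι => scH' d L mv kk r hL k p.1) ∘ₗ scNV' d L mv kk r hL a ι e w U k ∘ₗ (LinearMap.id - mulOp (fun p : ScX' d L mv kk r hL × ι => scBump' d L mv kk r hL k p.1)) = 0 := by
  rw [scNV'_eq ι e he a hwu U k]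
  exact mulOp_comp_mulVecLin_comp_one_sub_mulOp_eq_zero' ι _ (fun p q hpq => csavgSq_sub_apply_of_ne' ι a _ hpq) fun x x' hx hb => scBump'_eq_one_of_scH'_ne_zero_of_blockOf_eq hw hx hb

end FarRows

/-! ## §3 The fine summand's RIGHT locality -/

section RightLocality

variable {L : ℕ} [NeZero L] {mv kk r : ℕ} {hL : Odd L ∧ 1 < L} (ι : Type) [Fintype ι] [DecidableEq ι] {mm : Type} [Fintype mm] [DecidableEq mm] (e : Matrix mm mm ℂ ≃L[ℝ] (ι → ℝ))
variable (hM : ∀ ν, cvM d L mv kk hL ν = 2 * L * L ^ mv) (hm₂ : 2 * L ^ mv + 1 ≤ coverMargin L mv)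
  (hfit₂ : coverMargin L mv - 2 * L ^ mv + (6 * L ^ mv + 1) + 1 ≤ L * L ^ mv) (hS0 : L * L ^ mv ≤ 2 * L * L ^ mv)
include hM hm₂ hfit₂ hS0

/-- ★★ **THE RIGHT LOCALITY OF THE FINE SUMMAND** (n15-c∕429's `hPloc′`): `M_{h′_k}∘P′∘M_{1−ψ′_k} = 0` for `P′ = scP′ … U′ = a·Q′_T(U′)ᵀQ′_T(U′)`, every bond field `U′` — the covariant
Gram is block-diagonal (dag-n15-a `mulOp_comp_csavgGram_comp_mulOp_eq_zero`), `χ′_k` is block-constant, and a box point is under the plateau (n15-c∕428b `scPsi'_near_scChi'`).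
[cite: Balaban1985BackgroundPropagators, (3.19) p.393, (3.24) p.394 (block structure: shape); Balaban1984PropagatorsII, (2.37) p.229 (shape)] -/
theorem mulOp_scH'_comp_scP'_comp_one_sub_scPsi' (a : ℝ) (U' : Fin (d + 1) → ScX' d L mv kk r hL → Matrix mm mm ℂ) (k : Fin (d + 1) → ZMod (2 * L))
    (hhχ : ∀ x, scH' d L mv kk r hL k x ≠ 0 → scChi' d L mv kk r hL k x ≠ 0) :
    mulOp (fun p : ScX' d L mv kk r hL × ι => scH' d L mv kk r hL k p.1) ∘ₗ scP' d L mv kk r hL a ι e U' ∘ₗ mulOp (fun p : ScX' d L mv kk r hL × ι => 1 - scPsi' d L mv kk r hL k p.1) = 0 := by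
  rw [scP']
  refine mulOp_comp_csavgGram_comp_mulOp_eq_zero (cvM d L mv kk hL) (L ^ r * L ^ kk) (cvT e U') a (a := scH' d L mv kk r hL k) (b := fun x => 1 - scPsi' d L mv kk r hL k x) fun x z hb => ?_
  by_cases h0 : scH' d L mv kk r hL k x = 0
  · rw [h0, zero_mul]
  · have hχx : scChi' d L mv kk r hL k x ≠ 0 := hhχ x h0
    have hχz : scChi' d L mv kk r hL k z ≠ 0 := by
      have ez : scChi' d L mv kk r hL k z = scChi' d L mv kk r hL k x := by simp only [scChi', chiCube, hb]
      rw [ez]; exact hχx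
    rw [(scPsi'_near_scChi' hM hm₂ hfit₂ hS0 0 k hχz).1, sub_self, mul_zero]

end RightLocality

end Summit.QuantumFields.YangMills.BalabanUVNodes.N15.Gluing

end
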